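import Summits.AnomalousDissipation.AnomalousDissipation.Theorems.ImpulseGridGridThesisStubNoReversalOfSubthresholdWake

/-!
# Line `Sketch` for crux `GridSignsLaw` (item stmt-AnomalousDissipation-14349, route ImpulseGrid) —
stub `stub_wakeEnergyFloor`: a grid wake is never quiet

Companion free law of the line `Sketch` of the crux
`Summit.AnomalousDissipation.AnomalousDissipation.Theses.ImpulseGrid.GridSignsLaw`. For the
slab⊗transverse force `Φ•G` (`G` smooth, `x₀`-invariant, `G₀ ≡ 0`, divergence free, with the
strain bound `|⟪ξ,(ξ·∇)G⟫| ≤ σ‖ξ‖²`), every constant `c` and every global Leray–Hopf solution `u`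
with a sup-energy bound, in every generalized long-time limit `Λ`:

`∫Φ‖G‖² + νΛ⟨(u,ΔG)⟩ ≤ σ·Λ⟨‖u − c e₀‖₂²⟩`.

Proof. The mean momentum balance tested with `G` (`meanMomentumBalance_proof`, item
stmt-AnomalousDissipation-1773) reads `Λ⟨∫⟪u,(u·∇)G⟫⟩ + νΛ⟨(u,ΔG)⟩ + ∫Φ‖G‖² = 0`. Pointwise in
time, with `w = u(t) − c e₀`, `∫⟪u,(u·∇)G⟫ = ∫⟪w,(w·∇)G⟫` (`∂₀G = 0`, `G₀ ≡ 0`;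
`GridInjection.integral_inner_convect_eq_shift`) and the strain bound gives
`|∫⟪w,(w·∇)G⟫| ≤ σ∫‖w‖²` (`WakeEnergyFloor.abs_integral_inner_convect_le`). Both time functions
are interval integrable on every `[0,T]` and bounded on `[0,∞)` by the sup-energy clause, so the
Cesàro means satisfy `T⁻¹∫₀ᵀ(−σ‖w‖₂²) ≤ T⁻¹∫₀ᵀ∫⟪u,(u·∇)G⟫` and are bounded; monotonicity of
generalized limits on eventually bounded functions (`GeneralizedLimit.apply_mono`, FMRT 2001
Ch. IV (1.35)) gives `−σΛ⟨‖w‖₂²⟩ ≤ Λ⟨∫⟪u,(u·∇)G⟫⟩ = −∫Φ‖G‖² − νΛ⟨(u,ΔG)⟩`.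

References: Foias–Manley–Rosa–Temam 2001, Ch. IV §1.3 (1.35)–(1.37), §3.1; Doering–Foias 2002 §2.
No new definitions.
-/

noncomputable section

-- `Summit.<Summit>.<Problem>` is the tree's mandated summit-side namespace (CONVENTIONS §2); for this
-- single-conjunct summit the two coincide, so the duplicate is deliberate.
set_option linter.dupNamespace false

open MeasureTheory Set Filter Topology
open scoped InnerProductSpace RealInnerProductSpace

namespace Summit.AnomalousDissipation.AnomalousDissipation.Theorems

open Literature.Analysis.FunctionSpaces Literature.Analysis.FunctionSpaces.Torus
open Literature.Analysis.FluidPDE Literature.Analysis.FluidPDE.Torus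

local notation "𝕋³" => UnitAddTorus (Fin 3)
local notation "E³" => EuclideanSpace ℝ (Fin 3)

namespace WakeEnergyFloor

variable {G U : 𝕋³ → E³}

/-- **Two-sided production bound.** Let `G` be smooth with `G₀ ≡ 0`, `∂₀ G = 0` and the strain
bound `|⟪ξ, (ξ·∇)G⟫| ≤ σ‖ξ‖²`, let `U ∈ L²` and `c` any constant. Then
`|∫ ⟪U, (U·∇)G⟫| ≤ σ ∫‖U − c e₀‖²`: with `W = U − c e₀`, `∫⟪U,(U·∇)G⟫ = ∫⟪W,(W·∇)G⟫`
(`GridInjection.integral_inner_convect_eq_shift`) and `|⟪W,(W·∇)G⟫| ≤ σ‖W‖²` pointwise. [folklore] -/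
theorem abs_integral_inner_convect_le (hG : IsSmooth G) (hG0 : ∀ y, G y 0 = 0)
    (hdG : ∀ y, partialDeriv 0 G y = 0) {σ : ℝ}
    (hstrain : ∀ (x : 𝕋³) (ξ : E³), |⟪ξ, convect (fun _ => ξ) G x⟫| ≤ σ * ‖ξ‖ ^ 2)
    (hU : MemLp U 2 volume) (c : ℝ) :
    |∫ x, ⟪U x, convect U G x⟫| ≤ σ * ∫ x, ‖U x - c • EuclideanSpace.single 0 1‖ ^ 2 := by
  have hdG' : ∀ y, partialDeriv 0 G y = (fun _ => (0 : ℝ)) y • G y := fun y => by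
    rw [zero_smul]
    exact hdG y
  have hWmem : MemLp (fun y => U y - c • EuclideanSpace.single (0 : Fin 3) (1 : ℝ)) 2 volume :=
    hU.sub (memLp_const _)
  have i1 := integrable_inner_convect_self hWmem hG
  have i2 : Integrable (fun x => ‖U x - c • EuclideanSpace.single (0 : Fin 3) (1 : ℝ)‖ ^ 2) volume :=
    hWmem.integrable_norm_pow two_ne_zero
  -- the pointwise strain bound on the shifted field
  have hlo : ∀ x, -(σ * ‖U x - c • EuclideanSpace.single (0 : Fin 3) (1 : ℝ)‖ ^ 2) ≤
      ⟪U x - c • EuclideanSpace.single 0 1,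
        convect (fun y => U y - c • EuclideanSpace.single 0 1) G x⟫ :=
    fun x => (abs_le.1 (hstrain x (U x - c • EuclideanSpace.single 0 1))).1
  have hhi : ∀ x, ⟪U x - c • EuclideanSpace.single 0 1,
      convect (fun y => U y - c • EuclideanSpace.single 0 1) G x⟫ ≤
      σ * ‖U x - c • EuclideanSpace.single (0 : Fin 3) (1 : ℝ)‖ ^ 2 :=
    fun x => (abs_le.1 (hstrain x (U x - c • EuclideanSpace.single 0 1))).2
  rw [GridInjection.integral_inner_convect_eq_shift hG hG.continuous continuous_const hG0 hG0 hdG'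
    c hU]
  simp only [zero_mul, integral_zero, mul_zero, add_zero]
  refine abs_le.2 ⟨?_, ?_⟩
  · calc -(σ * ∫ x, ‖U x - c • EuclideanSpace.single 0 1‖ ^ 2)
          = ∫ x, -(σ * ‖U x - c • EuclideanSpace.single (0 : Fin 3) (1 : ℝ)‖ ^ 2) := by
          rw [integral_neg, integral_const_mul]
      _ ≤ _ := integral_mono (i2.const_mul σ).neg i1 hlo
  · calc (∫ x, ⟪U x - c • EuclideanSpace.single 0 1,
          convect (fun y => U y - c • EuclideanSpace.single 0 1) G x⟫)
          ≤ ∫ x, σ * ‖U x - c • EuclideanSpace.single (0 : Fin 3) (1 : ℝ)‖ ^ 2 :=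
          integral_mono i1 (i2.const_mul σ) hhi
      _ = σ * ∫ x, ‖U x - c • EuclideanSpace.single 0 1‖ ^ 2 := integral_const_mul _ _

variable {ν : ℝ} {F u₀ : 𝕋³ → E³} {u : ℝ → 𝕋³ → E³}

/-- **The wake energy is bounded along a bounded-energy trajectory.** If `½‖u(t)‖₂² ≤ C` for
`t ≥ 0` along a global Leray–Hopf solution, then for every constant vector `v` and `t ≥ 0`,
`0 ≤ ∫‖u(t) − v‖² ≤ 2C + 2‖v‖·½(1 + 2C) + ‖v‖²`
(`∫‖u − v‖² = ∫‖u‖² − 2∫⟪u,v⟫ + ‖v‖²` on the torus of volume one, and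
`|∫⟪u,v⟫| ≤ ‖v‖·½(1 + 2C)`). [folklore] -/
theorem abs_integral_norm_sub_const_sq_le (hu : IsGlobalLerayHopf ν (fun _ => F) u₀ u) {C : ℝ}
    (hC : ∀ t : ℝ, 0 ≤ t → kineticEnergy (u t) ≤ C) (v : E³) {t : ℝ} (ht : 0 ≤ t) :
    |∫ x, ‖u t x - v‖ ^ 2| ≤ 2 * C + 2 * (‖v‖ * (2⁻¹ * (1 + 2 * C))) + ‖v‖ ^ 2 := by
  have hmem : MemLp (u t) 2 volume := hu.memLp_two ht
  rw [abs_of_nonneg (integral_nonneg fun x => sq_nonneg _),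
    NoReversal.integral_norm_sub_const_sq hmem v]
  have h1 : ∫ x, ‖u t x‖ ^ 2 ≤ 2 * C := by
    have h := hC t ht
    simp only [kineticEnergy] at h
    linarith
  have h2 : |∫ x, ⟪u t x, v⟫| ≤ ‖v‖ * (2⁻¹ * (1 + 2 * C)) :=
    impulseGrid_abs_integral_inner_le (Φ₀ := fun _ => v) hu (norm_nonneg v) (fun _ => le_rfl) hC ht
  have h3 := (abs_le.1 h2).1
  linarith

/-- **The wake energy is interval integrable in time** on every `[0, T]` along a global
Leray–Hopf solution: for `t ≥ 0`, `∫‖u(t) − v‖² = ∫‖u(t)‖² − 2∫⟪u(t),v⟫ + ‖v‖²`, and the energy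
slice and the pairing with a constant field are integrable on `(0, T]`. [folklore] -/
theorem intervalIntegrable_integral_norm_sub_const_sq (hu : IsGlobalLerayHopf ν (fun _ => F) u₀ u)
    (v : E³) {T : ℝ} (hT : 0 < T) :
    IntervalIntegrable (fun t => ∫ x, ‖u t x - v‖ ^ 2) volume 0 T := by
  have h1 : IntervalIntegrable (fun t => ∫ x, ‖u t x‖ ^ 2) volume 0 T :=
    (intervalIntegrable_iff_integrableOn_Ioc_of_le hT.le).2 (hu.integrableOn_integral_norm_sq hT)
  have h2 : IntervalIntegrable (fun t => ∫ x, ⟪u t x, v⟫) volume 0 T :=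
    GridInjection.intervalIntegrable_inner hu continuous_const hT
  have h3 : IntervalIntegrable (fun _ => ‖v‖ ^ 2) volume 0 T := intervalIntegrable_const
  refine ((h1.sub (h2.const_mul 2)).add h3).congr fun t ht => ?_
  rw [uIoc_of_le hT.le] at ht
  exact (NoReversal.integral_norm_sub_const_sq (hu.memLp_two ht.1.le) v).symm

end WakeEnergyFloor

/-- **Stub `stub_wakeEnergyFloor` of line `Sketch` (crux `GridSignsLaw`,
stmt-AnomalousDissipation-14349): a grid wake is never quiet — ν-uniform floor on the mean wake
energy.** For the slab⊗transverse force `Φ•G` (`G` smooth, `x₀`-invariant, `G₀ ≡ 0`, divergence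
free, with the strain bound `|⟪ξ,(ξ·∇)G⟫| ≤ σ‖ξ‖²`), every constant `c` and every global
Leray–Hopf solution with a sup-energy bound: `∫Φ‖G‖² + νΛ⟨(u,ΔG)⟩ ≤ σ·Λ⟨‖u − c e₀‖₂²⟩`. Proof:
the mean momentum balance at the test field `G` (`meanMomentumBalance_proof`) reads
`Λ⟨∫⟪u,(u·∇)G⟫⟩ + νΛ⟨(u,ΔG)⟩ + ∫Φ‖G‖² = 0`; pointwise in time
`∫⟪u,(u·∇)G⟫ = ∫⟪w,(w·∇)G⟫ ≥ −σ∫‖w‖²`, `w = u − c e₀`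
(`WakeEnergyFloor.abs_integral_inner_convect_le`: `GridInjection.integral_inner_convect_eq_shift`
with `θ = 0` and the strain bound); both sides are interval integrable on every `[0,T]` and bounded
on `[0,∞)` by the sup-energy clause, and generalized limits are monotone on functions with bounded
Cesàro means (`GeneralizedLimit.apply_mono`, FMRT 2001 Ch. IV (1.35)). Consequences: the mean wake
energy `Λ⟨‖u − c e₀‖₂²⟩` of every bounded-energy drift family is `≥ ∫Φ‖G‖²/σ − O(ν_j)`, and the
sub-threshold regime of `stub_noReversalOfSubthresholdWake` is saturated in the mean as `ν → 0`.
[folklore] -/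
theorem stub_wakeEnergyFloor :
    ∀ (Λ : GeneralizedLimit) (ν c σ : ℝ) (Φ : 𝕋³ → ℝ) (G : 𝕋³ → E³) (u₀ : 𝕋³ → E³)
      (u : ℝ → 𝕋³ → E³),
      0 < ν → IsSmooth Φ → IsSmooth G →
      (∀ (s : UnitAddCircle) x, G (x + Pi.single (0 : Fin 3) s) = G x) → (∀ x, G x 0 = 0) →
      IsDivFree G →
      (∀ (x : 𝕋³) (ξ : E³), |⟪ξ, convect (fun _ => ξ) G x⟫| ≤ σ * ‖ξ‖ ^ 2) →
      IsGlobalLerayHopf ν (fun _ => fun x => Φ x • G x) u₀ u →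
      (∃ C : ℝ, ∀ t : ℝ, 0 ≤ t → kineticEnergy (u t) ≤ C) →
      (∫ x, Φ x * ‖G x‖ ^ 2) + ν * Λ.longTimeAvg (fun t => ∫ x, ⟪u t x, laplacian G x⟫) ≤
        σ * Λ.longTimeAvg (fun t => ∫ x, ‖u t x - c • EuclideanSpace.single 0 1‖ ^ 2) := by
  intro Λ ν c σ Φ G u₀ u hν hΦ hG hGinv hG0 hdivG hstrain hu hE
  -- the design
  have hFs : IsSmooth (fun x => Φ x • G x) := hΦ.smul' hG
  have hF : MemLp (fun x => Φ x • G x) 2 volume := hFs.memLp 2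
  have hdG : ∀ y, partialDeriv 0 G y = 0 :=
    GridInjection.partialDeriv_eq_zero_of_forall_add_single hGinv
  -- the mean momentum balance tested with `G` (item stmt-AnomalousDissipation-1773)
  have hMG := meanMomentumBalance_proof Λ ν (fun x => Φ x • G x) G u₀ u hν hFs hG hdivG hu hE
  have hFG : ∫ x, ⟪Φ x • G x, G x⟫ = ∫ x, Φ x * ‖G x‖ ^ 2 := by
    refine integral_congr_ae (ae_of_all _ fun x => ?_)
    simp only [real_inner_smul_left, real_inner_self_eq_norm_sq]
  obtain ⟨C, hC⟩ := hE
  -- the bound `B` on the wake energy `∫‖u(t) − c e₀‖²`, `t ≥ 0`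
  set B : ℝ := 2 * C + 2 * (‖c • (EuclideanSpace.single 0 1 : E³)‖ * (2⁻¹ * (1 + 2 * C))) +
    ‖c • (EuclideanSpace.single 0 1 : E³)‖ ^ 2 with hB
  have hWbd : ∀ t : ℝ, 0 ≤ t → |∫ x, ‖u t x - c • EuclideanSpace.single 0 1‖ ^ 2| ≤ B :=
    fun t ht => WakeEnergyFloor.abs_integral_norm_sub_const_sq_le hu hC _ ht
  -- the two-sided production bound, `t ≥ 0`
  have hAbd : ∀ t : ℝ, 0 ≤ t → |∫ x, ⟪u t x, convect (u t) G x⟫| ≤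
      σ * ∫ x, ‖u t x - c • EuclideanSpace.single 0 1‖ ^ 2 := fun t ht =>
    WakeEnergyFloor.abs_integral_inner_convect_le hG hG0 hdG hstrain (hu.memLp_two ht) c
  -- monotonicity of the generalized limit on the Cesàro means
  have hmono : Λ.longTimeAvg (fun t => (-σ) * ∫ x, ‖u t x - c • EuclideanSpace.single 0 1‖ ^ 2) ≤
      Λ.longTimeAvg (fun t => ∫ x, ⟪u t x, convect (u t) G x⟫) := by
    unfold GeneralizedLimit.longTimeAvg
    refine Λ.apply_mono ?_ ?_ ?_
    · refine isBoundedUnder_ge_timeMean (C := |σ| * B) fun t ht => ?_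
      rw [abs_mul, abs_neg]
      exact mul_le_mul_of_nonneg_left (hWbd t ht.le) (abs_nonneg σ)
    · refine isBoundedUnder_le_timeMean (C := |σ| * B) fun t ht => ?_
      refine (hAbd t ht.le).trans ?_
      have h0 : 0 ≤ ∫ x, ‖u t x - c • (EuclideanSpace.single 0 1 : E³)‖ ^ 2 :=
        integral_nonneg fun x => sq_nonneg _
      calc σ * ∫ x, ‖u t x - c • EuclideanSpace.single 0 1‖ ^ 2
          ≤ |σ| * ∫ x, ‖u t x - c • EuclideanSpace.single 0 1‖ ^ 2 :=
          mul_le_mul_of_nonneg_right (le_abs_self σ) h0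
        _ ≤ |σ| * B := mul_le_mul_of_nonneg_left ((le_abs_self _).trans (hWbd t ht.le))
          (abs_nonneg σ)
    · filter_upwards [eventually_gt_atTop 0] with T hT
      unfold timeMean
      refine mul_le_mul_of_nonneg_left ?_ (inv_nonneg.2 hT.le)
      refine intervalIntegral.integral_mono_on hT.le
        ((WakeEnergyFloor.intervalIntegrable_integral_norm_sub_const_sq hu _ hT).const_mul (-σ))
        (GridInjection.intervalIntegrable_inner_convect hF hu hG hT) fun t ht => ?_
      have h := (abs_le.1 (hAbd t ht.1)).1
      linarith
  rw [GridInjection.longTimeAvg_const_mul] at hmono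
  rw [hFG] at hMG
  linarith

end Summit.AnomalousDissipation.AnomalousDissipation.Theorems

end
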